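import Mathlib.Analysis.SpecialFunctions.Trigonometric.Bounds
import Summits.NavierStokesRegularity.NavierStokesRegularity.Theorems.SoloRefuteKyritsis2022Visc
import HarnessLib

/-!
# NS-claims map, C03 (Kyritsis 2022), part 5: `not_Step_9`

Negation of `Literature.Claims.NS.Kyritsis2022.Step_9` — Thm 4.3, ball form (4.7)/(4.8),
pp. 2552–2553 of K. E. Kyritsis, J. Appl. Math. Phys. 10 (2022) 2538–2560 («similarly for the 3D
volume integration … ω_B(0) > ω_B(t)» for the material images of «initial finite spherical
particles» in a viscous flow), the statement consumed by `theorem44Finite_of_steps` in the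
Navier–Stokes branch.  Countermodel: the viscous two-mode shear flow of part 4
(`SoloRefuteKyritsis2022Visc.lean`), reference parametrisation `Φ = Ψ = id` (the printed
spherical-particle case itself), ball `B(0,1/4)`, axis `e₁`, `T = t = 1`: the material flux
average of Def. 4.1 equals `⨍_{B(0,1/4)} (e^{−t} cos y₀ − 2e^{−4t} cos 2y₀) dy`, which is `≤ 0`
at `t = 0` and `> 0` at `t = 1` (the fast mode decays first), against the asserted strict
decrease from a positive value.  Axioms: `propext`, `Classical.choice`, `Quot.sound` only.
WHAT THIS IS NOT: not a claim about NS regularity or blow-up; not a claim about any author beyond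
the typed locator.
-/

noncomputable section

open Real Set Function MeasureTheory InnerProductSpace
open Literature.Analysis.FluidPDE
open scoped ContDiff RealInnerProductSpace

-- The summit's canonical theorem namespace repeats the summit name (single-conjunct summit).
set_option linter.dupNamespace false

namespace Summit.NavierStokesRegularity.NavierStokesRegularity.Theorems.Kyritsis2022

/-! ## The two flux averages -/

/-- The material integrand of Def. 4.1 at time `t`: the vorticity `ω = (0, −∂ₛφ, 0)` is carried
unchanged by `DY(t)`, so `⟪DY(t)_{X(t,y)} ω(t,X(t,y)), e₁⟫ = −∂ₛφ(t,y₀)`. -/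
theorem integrand_visc (t : ℝ) (y : EuclideanSpace ℝ (Fin 3)) :
    ⟪(fderiv ℝ (viscY t) (viscX t y)) (curl (visc t) (viscX t y)), bv 1⟫ = -profD t (y 0) := by
  rw [curl_visc, (hasFDerivAt_viscY t _).fderiv]
  simp

/-- On the ball `B(0,1/4)` the first coordinate is at most `1/4` in absolute value. -/
theorem abs_apply_zero_le {y : EuclideanSpace ℝ (Fin 3)}
    (hy : y ∈ Metric.ball (0 : EuclideanSpace ℝ (Fin 3)) (1 / 4)) : |y 0| ≤ 1 / 4 := by
  rw [Metric.mem_ball, dist_zero_right] at hy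
  have := PiLp.norm_apply_le y 0
  rw [Real.norm_eq_abs] at this
  linarith

/-- At time `0` the integrand `cos y₀ − 2 cos 2y₀` is negative on `B(0,1/4)`. -/
theorem integrand_visc_zero_nonpos {y : EuclideanSpace ℝ (Fin 3)}
    (hy : y ∈ Metric.ball (0 : EuclideanSpace ℝ (Fin 3)) (1 / 4)) : -profD 0 (y 0) ≤ 0 := by
  have h0 := abs_apply_zero_le hy
  obtain ⟨hl, hu⟩ := abs_le.mp h0
  rw [profD_zero]
  have h1 := cos_le_one (y 0)
  have h2 := Real.one_sub_sq_div_two_le_cos (x := 2 * y 0)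
  nlinarith

/-- At time `1` the integrand `e^{−1} cos y₀ − 2e^{−4} cos 2y₀` is at least `(15/32)e^{−1}` on
`B(0,1/4)`. -/
theorem le_integrand_visc_one {y : EuclideanSpace ℝ (Fin 3)}
    (hy : y ∈ Metric.ball (0 : EuclideanSpace ℝ (Fin 3)) (1 / 4)) :
    15 / 32 * exp (-1) ≤ -profD 1 (y 0) := by
  have h0 := abs_apply_zero_le hy
  obtain ⟨hl, hu⟩ := abs_le.mp h0
  have h1 : 31 / 32 ≤ cos (y 0) := by
    have := Real.one_sub_sq_div_two_le_cos (x := y 0)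
    nlinarith
  have h2 := cos_le_one (2 * y 0)
  have he1 : 0 < exp (-1 : ℝ) := exp_pos _
  have he3 : exp (-3 : ℝ) ≤ 1 / 4 := by
    rw [Real.exp_neg]
    have h := Real.add_one_le_exp (3 : ℝ)
    rw [one_div]
    exact inv_anti₀ (by norm_num) (by linarith)
  have he3' : 0 ≤ exp (-3 : ℝ) := (exp_pos _).le
  have he4 : exp (-4 : ℝ) = exp (-1) * exp (-3) := by
    rw [← Real.exp_add]
    norm_num
  simp only [profD, mul_one, he4]
  nlinarith [mul_le_mul_of_nonneg_left h1 he1.le, mul_le_mul_of_nonneg_left he3 he1.le,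
    mul_le_mul_of_nonneg_left h2 (mul_nonneg he1.le he3')]

/-- At time `0` the flux average (identity parametrisation = round ball `B(0,1/4)`, axis `e₁`)
is `≤ 0`. -/
theorem imageFluxAvg_visc_zero_nonpos :
    Literature.Claims.NS.Kyritsis2022.imageFluxAvg (curl (visc 0)) id id (bv 1) 0 (1 / 4) ≤ 0 := by
  rw [Literature.Claims.NS.Kyritsis2022.imageFluxAvg_id]
  unfold Literature.Claims.NS.Kyritsis2022.ballAvg
  simp only [curl_visc, real_inner_smul_left, inner_bv_right, bv_apply, if_true, mul_one]
  rw [setAverage_eq, smul_eq_mul]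
  exact mul_nonpos_iff.mpr (Or.inl ⟨inv_nonneg.mpr measureReal_nonneg,
    setIntegral_nonpos measurableSet_ball fun y hy => integrand_visc_zero_nonpos hy⟩)

/-- At time `1` the material flux average of Def. 4.1 through the image of `B(0,1/4)` along `e₁`
is positive. -/
theorem imageFluxAvg_visc_one_pos :
    0 < Literature.Claims.NS.Kyritsis2022.imageFluxAvg (curl (visc 1)) (viscX 1 ∘ id)
      (id ∘ viscY 1) (bv 1) 0 (1 / 4) := by
  unfold Literature.Claims.NS.Kyritsis2022.imageFluxAvg
  simp_rw [Function.comp_id, Function.id_comp, integrand_visc]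
  set B := Metric.ball (0 : EuclideanSpace ℝ (Fin 3)) (1 / 4) with hB
  have hBpos : 0 < volume B := Metric.measure_ball_pos volume _ (by norm_num)
  have hBfin : volume B ≠ ⊤ := measure_ball_lt_top.ne
  have hreal : 0 < volume.real B := ENNReal.toReal_pos hBpos.ne' hBfin
  have hcont : Continuous fun y : EuclideanSpace ℝ (Fin 3) => -profD 1 (y 0) := by
    unfold profD
    fun_prop
  have hint : IntegrableOn (fun y : EuclideanSpace ℝ (Fin 3) => -profD 1 (y 0)) B volume :=
    (hcont.continuousOn.integrableOn_compact (isCompact_closedBall 0 (1 / 4))).mono_set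
      Metric.ball_subset_closedBall
  have hge := setIntegral_ge_of_const_le_real measurableSet_ball hBfin
    (fun y hy => le_integrand_visc_one hy) hint
  have hc : 0 < 15 / 32 * exp (-1 : ℝ) := by positivity
  rw [setAverage_eq, smul_eq_mul]
  have h1 : 15 / 32 * exp (-1 : ℝ) ≤ (volume.real B)⁻¹ * ∫ y in B, -profD 1 (y 0) := by
    rw [le_inv_mul_iff₀ hreal]
    linarith
  linarith

/-- `det D(id) = 1`. [folklore] -/
theorem det_fderiv_id (z : EuclideanSpace ℝ (Fin 3)) :
    (fderiv ℝ (id : EuclideanSpace ℝ (Fin 3) → EuclideanSpace ℝ (Fin 3)) z).det = 1 := by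
  rw [fderiv_id]
  simp [ContinuousLinearMap.det]

/-- **`Step_9` of the typed skeleton is false.** Locator: Kyritsis 2022, Thm 4.3, ball form
(4.7)/(4.8), pp. 2552–2553 («ω_B(0) > ω_B(t)» for the material images of spherical particles
in a viscous flow); skeleton decl `Literature.Claims.NS.Kyritsis2022.Step_9` (consumed by
`theorem44Finite_of_steps`, Navier–Stokes branch). Countermodel: the two-mode heat-equation shear
flow `u = (0, 0, −e^{−t} sin y₀ + e^{−4t} sin 2y₀)` (`ν = 1`, no force, zero pressure — a global
classical Navier–Stokes solution with explicit volume-preserving trajectory maps), reference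
parametrisation `Φ = Ψ = id`, ball `B(0,1/4)`, axis `e₁`, `T = t = 1`: the material flux average
is `≤ 0` at time `0` and `> 0` at time `1` (decay of the fast mode raises the average), whereas the
Step asserts that a positive value at time `t` is strictly below the initial one.
Axioms: propext, Classical.choice, Quot.sound. -/
theorem not_Step_9 : ¬ Literature.Claims.NS.Kyritsis2022.Step_9 := by
  intro h
  have hlt := h 1 one_pos 1 one_pos visc (fun _ _ => 0)
    (isClassicalNSSolutionOn_visc (uniqueDiffOn_Icc one_pos)) viscX viscY (isFlowOn_visc _)
    id id contDiff_id contDiff_id (fun _ => rfl) (fun _ => rfl) det_fderiv_id det_fderiv_id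
    (bv 1) (norm_bv 1) 0 (1 / 4) (by norm_num) 1 ⟨one_pos, le_rfl⟩ imageFluxAvg_visc_one_pos
  have h0 := imageFluxAvg_visc_zero_nonpos
  have h1 := imageFluxAvg_visc_one_pos
  linarith

end Summit.NavierStokesRegularity.NavierStokesRegularity.Theorems.Kyritsis2022

end
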